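import Summits.CriticalPhenomena.PercolationContinuityZ3.Theorems.PercNearOneGluingAdditiveGluingThreeRelaysRegion
import HarnessLib

/-! # Crux `PercNearOneGluing.AdditiveGluing` (stmt-CriticalPhenomena-4576): three relays —
# the ψ-certificate: the bad region reduced to ONE inequality on the atoms of `C(b) ∩ A` (no badness, no Lemma 2)

Support file (`--supports stmt-CriticalPhenomena-4576`, deep seat r2).  No definitions, no named facts, no sorries.
Notation as in `…ThreeRelaysRegion`: `μ = prodBernoulli w`, relays `a₁ a₂ a₃` (distinct, `a₃` worst), target `b`,
observer `o`; `N₁₂ = {a₁↮a₃} ∩ {a₂↮a₃}`, `N₁ = {a₁↮a₂} ∩ {a₁↮a₃}`, `N₂ = {a₂↮a₁} ∩ {a₂↮a₃}`; the atoms of the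
`b`-pattern `T = C(b) ∩ A`: `m₃ = μ(N₁₂ ∩ a₃b)`, `m₁₂ = μ(N₁₂ ∩ a₁b ∩ a₂b)`, `m₁ = μ(N₁ ∩ a₁b)`, `m₂₃ = μ(N₁ ∩ a₂b ∩ a₃b)`,
`m₂ = μ(N₂ ∩ a₂b)`, `m₁₃ = μ(N₂ ∩ a₁b ∩ a₃b)`; Kozma–Nitzan's six terms `T₁₂, U₁₂, T₁, U₁, T₂, U₂`
(`U₁₂ = μ(T = {a₃}, o ↔ {a₁,a₂})`, `T₁ = μ(T = {a₁}, o ↔ b)`, `T₂ = μ(T = {a₂}, o ↔ b)`), the additive room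
`D = μ(o↮A, a₃↮b)`.

**The ψ-route.**  KN bound their three terms by `φ`'s (conditional on the separation events) and needed Lemma 2
(`φ₁₂ ≥ φ₁ + φ₂`), which has the wrong sign in the bad region `m₁₂ < m₃`.  The SAME six set-BHK inequalities give the
sharper "sandwich" bounds with coefficients conditional on the exact `b`-pattern:
  `m₃·T₁₂ ≥ m₁₂·U₁₂` (i.e. `I ≥ −z₃(m₃−m₁₂)`, `z₃ = U₁₂/m₃ = P(o↔{a₁,a₂} | T={a₃})`),
  `m₁·U₁ ≤ m₂₃·T₁` (i.e. `II ≥ x₁(m₁−m₂₃)`, `x₁ = T₁/m₁ = P(o↔b | T={a₁})`), `m₂·U₂ ≤ m₁₃·T₂`,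
so that `X + D ≥ 0` — the additive inequality for three relays — follows from the **ψ-certificate**
  (Ψ)  `U₁₂·(m₃−m₁₂)·m₁·m₂ ≤ T₁·(m₁−m₂₃)·m₂·m₃ + T₂·(m₂−m₁₃)·m₁·m₃ + D·m₁·m₂·m₃`,
i.e. `z₃(m₃−m₁₂) ≤ x₁(m₁−m₂₃) + x₂(m₂−m₁₃) + D`.  (Ψ) is WEAKER than the registered certificate (T1)
(`stub_regionCertThreeRelays_d2`; `z₃ ≤ φ₁₂`, `xₖ ≥ φₖ`), involves only the joint law of `(C(b) ∩ {o,a₁,a₂,a₃},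
1{o ↔ aₖ})` — no relay-separation conditionals, no Lemma 2 — and numerically holds on the whole region
{`a₃` worst, `m₁₂ < m₃`} for EVERY observer `o` (deep seat r2, exact engine: 0 violations in 2.4·10⁴ exhaustive n = 5
instances and ≈ 5·10³ random n ≤ 7 instances; adversarial infimum of the normalised margin 1.009, attained only at the
identity locus `o ≡ a₁, τ₁ = τ₃`; it FAILS without `a₃` worst), whereas (T1) needs `τ(o) < τ₃`.
This file: `knThm2_psi_arith` (real arithmetic), `knThm2_psi_core` (measure form), `knThm2_psi_pos`,
`knThm2_psi_eform`, and the assembly `additiveGluing_threeRelays_of_psiCert` (ordered relays, `a₃` worst).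
[cite: KozmaNitzan2024, Theorem 2 (§3.2, pp. 8–9); VandenbergHaggstromKahn2005, Thms. 1.3–1.4]
-/

namespace Summit.CriticalPhenomena.PercolationContinuityZ3.Theorems

open MeasureTheory Set Literature.Probability.LatticeModels Literature.Probability.Percolation

noncomputable section
open Classical

variable {n : ℕ}

/-- **Arithmetic of the ψ-route**: KN's six BHK bounds `h1 … h6` (as in `knThm2_arith`), `P₁₂, P₁, P₂ > 0`,
`m₁, m₂, m₃ > 0`, `m₁₂, m₂₃, m₁₃ ≥ 0` and the ψ-certificate `hS` give `0 ≤ I + II + III + D`.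
[cite: KozmaNitzan2024, Theorem 2, proof (p. 9)] -/
theorem knThm2_psi_arith {T₁₂ U₁₂ T₁ U₁ T₂ U₂ P₁₂ P₁ P₂ A₁₂ A₁ A₂ m₁₂ m₃ m₁ m₂₃ m₂ m₁₃ D : ℝ}
    (hP₁₂ : 0 < P₁₂) (hP₁ : 0 < P₁) (hP₂ : 0 < P₂) (hm₃ : 0 < m₃) (hm₁ : 0 < m₁) (hm₂ : 0 < m₂)
    (hm₁₂ : 0 ≤ m₁₂) (hm₂₃ : 0 ≤ m₂₃) (hm₁₃ : 0 ≤ m₁₃)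
    (h1 : A₁₂ * m₁₂ ≤ P₁₂ * T₁₂) (h2 : P₁₂ * U₁₂ ≤ A₁₂ * m₃)
    (h3 : A₁ * m₁ ≤ P₁ * T₁) (h4 : P₁ * U₁ ≤ A₁ * m₂₃)
    (h5 : A₂ * m₂ ≤ P₂ * T₂) (h6 : P₂ * U₂ ≤ A₂ * m₁₃)
    (hS : U₁₂ * (m₃ - m₁₂) * m₁ * m₂ ≤ T₁ * (m₁ - m₂₃) * m₂ * m₃ + T₂ * (m₂ - m₁₃) * m₁ * m₃ + D * m₁ * m₂ * m₃) :
    0 ≤ (T₁₂ - U₁₂) + (T₁ - U₁) + (T₂ - U₂) + D := by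
  -- the three sandwiches `m₁₂ U₁₂ ≤ m₃ T₁₂`, `m₁ U₁ ≤ m₂₃ T₁`, `m₂ U₂ ≤ m₁₃ T₂`
  have ha : P₁₂ * (m₁₂ * U₁₂) ≤ P₁₂ * (m₃ * T₁₂) := by
    nlinarith [mul_le_mul_of_nonneg_left h2 hm₁₂, mul_le_mul_of_nonneg_left h1 hm₃.le]
  have ha' : m₁₂ * U₁₂ ≤ m₃ * T₁₂ := le_of_mul_le_mul_left ha hP₁₂
  have hb : P₁ * (m₁ * U₁) ≤ P₁ * (m₂₃ * T₁) := by
    nlinarith [mul_le_mul_of_nonneg_left h4 hm₁.le, mul_le_mul_of_nonneg_left h3 hm₂₃]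
  have hb' : m₁ * U₁ ≤ m₂₃ * T₁ := le_of_mul_le_mul_left hb hP₁
  have hc : P₂ * (m₂ * U₂) ≤ P₂ * (m₁₃ * T₂) := by
    nlinarith [mul_le_mul_of_nonneg_left h6 hm₂.le, mul_le_mul_of_nonneg_left h5 hm₁₃]
  have hc' : m₂ * U₂ ≤ m₁₃ * T₂ := le_of_mul_le_mul_left hc hP₂
  have hid : m₁ * m₂ * m₃ * ((T₁₂ - U₁₂) + (T₁ - U₁) + (T₂ - U₂) + D) =
      m₁ * m₂ * (m₃ * T₁₂ - m₁₂ * U₁₂) + m₂ * m₃ * (m₂₃ * T₁ - m₁ * U₁) + m₁ * m₃ * (m₁₃ * T₂ - m₂ * U₂) +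
        (T₁ * (m₁ - m₂₃) * m₂ * m₃ + T₂ * (m₂ - m₁₃) * m₁ * m₃ + D * m₁ * m₂ * m₃ -
          U₁₂ * (m₃ - m₁₂) * m₁ * m₂) := by ring
  have k1 : 0 ≤ m₁ * m₂ * (m₃ * T₁₂ - m₁₂ * U₁₂) := mul_nonneg (mul_nonneg hm₁.le hm₂.le) (by linarith)
  have k2 : 0 ≤ m₂ * m₃ * (m₂₃ * T₁ - m₁ * U₁) := mul_nonneg (mul_nonneg hm₂.le hm₃.le) (by linarith)
  have k3 : 0 ≤ m₁ * m₃ * (m₁₃ * T₂ - m₂ * U₂) := mul_nonneg (mul_nonneg hm₁.le hm₃.le) (by linarith)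
  have hpos : 0 < m₁ * m₂ * m₃ := mul_pos (mul_pos hm₁ hm₂) hm₃
  by_contra hneg
  push Not at hneg
  have hlt : m₁ * m₂ * m₃ * ((T₁₂ - U₁₂) + (T₁ - U₁) + (T₂ - U₂) + D) < 0 := mul_neg_of_pos_of_neg hpos hneg
  linarith

/-- **The bad region via the ψ-certificate, core inequality**: with the set-BHK inequalities `hB1, hB2` (the two
halves of the landed `stub_bhkSets`), `μ(N₁₂), μ(N₁), μ(N₂) > 0`, `m₁, m₂, m₃ > 0` and (Ψ) `hS`:
`μ(o↔A, a₃↔b) ≤ μ(o↔A, o↔b) + μ(o↮A, a₃↮b)`.  Proof: KN's six BHK bounds (`knThm2_bhkOne/Two`), the partitions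
`knThm2_partA/B`, and `knThm2_psi_arith`. [cite: KozmaNitzan2024, Theorem 2 (§3.2, pp. 8–9)] -/
theorem knThm2_psi_core
    (hB1 : ∀ (n : ℕ) (w : Sym2 (Fin n) → unitInterval) (S : Finset (Fin n)) (X : Set (Fin n))
        (F G : Set (Sym2 (Fin n)) → ℝ), Monotone F → Monotone G → (∀ s ∈ S, s ∉ X) →
        (∫ ω in {ω : BondConfig (Fin n) | ∀ s ∈ S, ∀ x ∈ X, ¬ (openGraph ω).Reachable s x},
            F (⋃ s ∈ S, openEdgeCluster ω s) ∂(prodBernoulli w)) *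
          (∫ ω in {ω : BondConfig (Fin n) | ∀ s ∈ S, ∀ x ∈ X, ¬ (openGraph ω).Reachable s x},
            G (⋃ s ∈ S, openEdgeCluster ω s) ∂(prodBernoulli w)) ≤
        (prodBernoulli w).real
            {ω : BondConfig (Fin n) | ∀ s ∈ S, ∀ x ∈ X, ¬ (openGraph ω).Reachable s x} *
          ∫ ω in {ω : BondConfig (Fin n) | ∀ s ∈ S, ∀ x ∈ X, ¬ (openGraph ω).Reachable s x},
            F (⋃ s ∈ S, openEdgeCluster ω s) * G (⋃ s ∈ S, openEdgeCluster ω s)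
              ∂(prodBernoulli w))
    (hB2 : ∀ (n : ℕ) (w : Sym2 (Fin n) → unitInterval) (S S' : Finset (Fin n))
        (F G : Set (Sym2 (Fin n)) → ℝ), Monotone F → Monotone G → Disjoint S S' →
        (prodBernoulli w).real
            {ω : BondConfig (Fin n) | ∀ s ∈ S, ∀ x ∈ S', ¬ (openGraph ω).Reachable s x} *
          (∫ ω in {ω : BondConfig (Fin n) | ∀ s ∈ S, ∀ x ∈ S', ¬ (openGraph ω).Reachable s x},
            F (⋃ s ∈ S, openEdgeCluster ω s) * G (⋃ s ∈ S', openEdgeCluster ω s)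
              ∂(prodBernoulli w)) ≤
        (∫ ω in {ω : BondConfig (Fin n) | ∀ s ∈ S, ∀ x ∈ S', ¬ (openGraph ω).Reachable s x},
            F (⋃ s ∈ S, openEdgeCluster ω s) ∂(prodBernoulli w)) *
          (∫ ω in {ω : BondConfig (Fin n) | ∀ s ∈ S, ∀ x ∈ S', ¬ (openGraph ω).Reachable s x},
            G (⋃ s ∈ S', openEdgeCluster ω s) ∂(prodBernoulli w)))
    (w : Sym2 (Fin n) → unitInterval) (o b a₁ a₂ a₃ : Fin n)
    (h12 : a₁ ≠ a₂) (h13 : a₁ ≠ a₃) (h23 : a₂ ≠ a₃)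
    (hP₁₂ : 0 < (prodBernoulli w).real ((openConn a₁ a₃)ᶜ ∩ (openConn a₂ a₃)ᶜ : Set (BondConfig (Fin n))))
    (hP₁ : 0 < (prodBernoulli w).real ((openConn a₁ a₂)ᶜ ∩ (openConn a₁ a₃)ᶜ : Set (BondConfig (Fin n))))
    (hP₂ : 0 < (prodBernoulli w).real ((openConn a₂ a₁)ᶜ ∩ (openConn a₂ a₃)ᶜ : Set (BondConfig (Fin n))))
    (hm₃ : 0 < (prodBernoulli w).real ((openConn a₁ a₃)ᶜ ∩ (openConn a₂ a₃)ᶜ ∩ openConn a₃ b))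
    (hm₁ : 0 < (prodBernoulli w).real ((openConn a₁ a₂)ᶜ ∩ (openConn a₁ a₃)ᶜ ∩ openConn a₁ b))
    (hm₂ : 0 < (prodBernoulli w).real ((openConn a₂ a₁)ᶜ ∩ (openConn a₂ a₃)ᶜ ∩ openConn a₂ b))
    (hS : (prodBernoulli w).real ((openConn a₁ a₃)ᶜ ∩ (openConn a₂ a₃)ᶜ ∩ ((openConn a₁ o ∪ openConn a₂ o) ∩ openConn a₃ b)) *
            ((prodBernoulli w).real ((openConn a₁ a₃)ᶜ ∩ (openConn a₂ a₃)ᶜ ∩ openConn a₃ b) -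
              (prodBernoulli w).real ((openConn a₁ a₃)ᶜ ∩ (openConn a₂ a₃)ᶜ ∩ (openConn a₁ b ∩ openConn a₂ b))) *
            (prodBernoulli w).real ((openConn a₁ a₂)ᶜ ∩ (openConn a₁ a₃)ᶜ ∩ openConn a₁ b) *
            (prodBernoulli w).real ((openConn a₂ a₁)ᶜ ∩ (openConn a₂ a₃)ᶜ ∩ openConn a₂ b) ≤
        (prodBernoulli w).real ((openConn a₁ a₂)ᶜ ∩ (openConn a₁ a₃)ᶜ ∩ (openConn a₁ o ∩ openConn a₁ b)) *
              ((prodBernoulli w).real ((openConn a₁ a₂)ᶜ ∩ (openConn a₁ a₃)ᶜ ∩ openConn a₁ b) -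
                (prodBernoulli w).real ((openConn a₁ a₂)ᶜ ∩ (openConn a₁ a₃)ᶜ ∩ (openConn a₂ b ∩ openConn a₃ b))) *
              (prodBernoulli w).real ((openConn a₂ a₁)ᶜ ∩ (openConn a₂ a₃)ᶜ ∩ openConn a₂ b) *
              (prodBernoulli w).real ((openConn a₁ a₃)ᶜ ∩ (openConn a₂ a₃)ᶜ ∩ openConn a₃ b) +
          (prodBernoulli w).real ((openConn a₂ a₁)ᶜ ∩ (openConn a₂ a₃)ᶜ ∩ (openConn a₂ o ∩ openConn a₂ b)) *
              ((prodBernoulli w).real ((openConn a₂ a₁)ᶜ ∩ (openConn a₂ a₃)ᶜ ∩ openConn a₂ b) -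
                (prodBernoulli w).real ((openConn a₂ a₁)ᶜ ∩ (openConn a₂ a₃)ᶜ ∩ (openConn a₁ b ∩ openConn a₃ b))) *
              (prodBernoulli w).real ((openConn a₁ a₂)ᶜ ∩ (openConn a₁ a₃)ᶜ ∩ openConn a₁ b) *
              (prodBernoulli w).real ((openConn a₁ a₃)ᶜ ∩ (openConn a₂ a₃)ᶜ ∩ openConn a₃ b) +
          (prodBernoulli w).real
                ((openConn o a₁ ∪ openConn o a₂ ∪ openConn o a₃)ᶜ ∩ (openConn a₃ b)ᶜ : Set (BondConfig (Fin n))) *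
              (prodBernoulli w).real ((openConn a₁ a₂)ᶜ ∩ (openConn a₁ a₃)ᶜ ∩ openConn a₁ b) *
              (prodBernoulli w).real ((openConn a₂ a₁)ᶜ ∩ (openConn a₂ a₃)ᶜ ∩ openConn a₂ b) *
              (prodBernoulli w).real ((openConn a₁ a₃)ᶜ ∩ (openConn a₂ a₃)ᶜ ∩ openConn a₃ b)) :
    (prodBernoulli w).real ((openConn o a₁ ∪ openConn o a₂ ∪ openConn o a₃) ∩ openConn a₃ b) ≤
      (prodBernoulli w).real ((openConn o a₁ ∪ openConn o a₂ ∪ openConn o a₃) ∩ openConn o b) +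
        (prodBernoulli w).real
          ((openConn o a₁ ∪ openConn o a₂ ∪ openConn o a₃)ᶜ ∩ (openConn a₃ b)ᶜ : Set (BondConfig (Fin n))) := by
  -- the six set-BHK bounds (KN p. 9), exactly as in `knThm2_core`
  have i1 := knThm2_bhkOne hB1 w {a₁, a₂} ({a₃} : Set (Fin n)) o b (by simp [h13, h23])
  have i2 := knThm2_bhkTwo hB2 w {a₁, a₂} {a₃} o b (by simp [h13.symm, h23.symm])
  have i3 := knThm2_bhkOne hB1 w {a₁} ({a₂, a₃} : Set (Fin n)) o b (by simp [h12, h13])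
  have i4 := knThm2_bhkTwo hB2 w {a₁} {a₂, a₃} o b (by simp [h12, h13])
  have i5 := knThm2_bhkOne hB1 w {a₂} ({a₁, a₃} : Set (Fin n)) o b (by simp [h12.symm, h23])
  have i6 := knThm2_bhkTwo hB2 w {a₂} {a₁, a₃} o b (by simp [h12.symm, h23])
  rw [knThm2_sep_pair_set, Finset.set_biUnion_insert, Finset.set_biUnion_singleton,
    Finset.set_biInter_insert, Finset.set_biInter_singleton] at i1
  rw [knThm2_sep_pair_finset, Finset.set_biUnion_insert, Finset.set_biUnion_singleton,
    Finset.set_biInter_singleton] at i2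
  rw [knThm2_sep_single_set, Finset.set_biUnion_singleton, Finset.set_biInter_singleton] at i3
  rw [knThm2_sep_single_finset, Finset.set_biUnion_singleton, Finset.set_biInter_insert,
    Finset.set_biInter_singleton] at i4
  rw [knThm2_sep_single_set, Finset.set_biUnion_singleton, Finset.set_biInter_singleton] at i5
  rw [knThm2_sep_single_finset, Finset.set_biUnion_singleton, Finset.set_biInter_insert,
    Finset.set_biInter_singleton] at i6
  -- `X = I + II + III`
  have hA := knThm2_partA w o b a₁ a₂ a₃
  have hB := knThm2_partB w o b a₁ a₂ a₃
  have key := knThm2_psi_arith hP₁₂ hP₁ hP₂ hm₃ hm₁ hm₂ measureReal_nonneg measureReal_nonneg measureReal_nonneg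
    i1 i2 i3 i4 i5 i6 hS
  linarith

/-- **Positivity of the single-relay atoms in the bad region**: if `m₁₂ < m₃` and `a₃` is a worst relay then
`m₃, m₁, m₂ > 0` (`τ₁ − τ₃ = (m₁ + m₁₂) − (m₃ + m₂₃)` forces `m₁ > m₂₃ ≥ 0`, similarly `m₂ > m₁₃ ≥ 0`).
[cite: KozmaNitzan2024, Theorem 2, proof (p. 9, eq. (7))] -/
theorem knThm2_psi_pos (w : Sym2 (Fin n) → unitInterval) (b a₁ a₂ a₃ : Fin n)
    (hτ31 : (prodBernoulli w).real (openConn a₃ b) ≤ (prodBernoulli w).real (openConn a₁ b))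
    (hτ32 : (prodBernoulli w).real (openConn a₃ b) ≤ (prodBernoulli w).real (openConn a₂ b))
    (hbad : (prodBernoulli w).real ((openConn a₁ a₃)ᶜ ∩ (openConn a₂ a₃)ᶜ ∩ (openConn a₁ b ∩ openConn a₂ b)) <
      (prodBernoulli w).real ((openConn a₁ a₃)ᶜ ∩ (openConn a₂ a₃)ᶜ ∩ openConn a₃ b)) :
    0 < (prodBernoulli w).real ((openConn a₁ a₃)ᶜ ∩ (openConn a₂ a₃)ᶜ ∩ openConn a₃ b) ∧
    0 < (prodBernoulli w).real ((openConn a₁ a₂)ᶜ ∩ (openConn a₁ a₃)ᶜ ∩ openConn a₁ b) ∧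
    0 < (prodBernoulli w).real ((openConn a₂ a₁)ᶜ ∩ (openConn a₂ a₃)ᶜ ∩ openConn a₂ b) := by
  have hτ1 := knThm2_tau_sub w b a₁ a₂ a₃
  have hτ2 := knThm2_tau_sub w b a₂ a₁ a₃
  rw [Set.inter_comm (openConn a₂ a₃)ᶜ (openConn a₁ a₃)ᶜ,
    Set.inter_comm (openConn a₂ b) (openConn a₁ b)] at hτ2
  have hm12 : 0 ≤ (prodBernoulli w).real
      ((openConn a₁ a₃)ᶜ ∩ (openConn a₂ a₃)ᶜ ∩ (openConn a₁ b ∩ openConn a₂ b)) := measureReal_nonneg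
  have hm23 : 0 ≤ (prodBernoulli w).real
      ((openConn a₁ a₂)ᶜ ∩ (openConn a₁ a₃)ᶜ ∩ (openConn a₂ b ∩ openConn a₃ b)) := measureReal_nonneg
  have hm13 : 0 ≤ (prodBernoulli w).real
      ((openConn a₂ a₁)ᶜ ∩ (openConn a₂ a₃)ᶜ ∩ (openConn a₁ b ∩ openConn a₃ b)) := measureReal_nonneg
  refine ⟨by linarith, by linarith, by linarith⟩

/-- **The bad region via (Ψ), additive E-form**: under the hypotheses of `knThm2_psi_core` with `a₃` worst and
`m₁₂ < m₃` (which give the positivity of `μ(N₁₂), μ(N₁), μ(N₂)` and of `m₃, m₁, m₂`),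
`μ({o ↔ A} ∖ {o ↔ b}) ≤ μ(a₃ ↮ b)`. [cite: KozmaNitzan2024, Theorem 2 (§3.2, pp. 8–9)] -/
theorem knThm2_psi_eform
    (hB1 : ∀ (n : ℕ) (w : Sym2 (Fin n) → unitInterval) (S : Finset (Fin n)) (X : Set (Fin n))
        (F G : Set (Sym2 (Fin n)) → ℝ), Monotone F → Monotone G → (∀ s ∈ S, s ∉ X) →
        (∫ ω in {ω : BondConfig (Fin n) | ∀ s ∈ S, ∀ x ∈ X, ¬ (openGraph ω).Reachable s x},
            F (⋃ s ∈ S, openEdgeCluster ω s) ∂(prodBernoulli w)) *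
          (∫ ω in {ω : BondConfig (Fin n) | ∀ s ∈ S, ∀ x ∈ X, ¬ (openGraph ω).Reachable s x},
            G (⋃ s ∈ S, openEdgeCluster ω s) ∂(prodBernoulli w)) ≤
        (prodBernoulli w).real
            {ω : BondConfig (Fin n) | ∀ s ∈ S, ∀ x ∈ X, ¬ (openGraph ω).Reachable s x} *
          ∫ ω in {ω : BondConfig (Fin n) | ∀ s ∈ S, ∀ x ∈ X, ¬ (openGraph ω).Reachable s x},
            F (⋃ s ∈ S, openEdgeCluster ω s) * G (⋃ s ∈ S, openEdgeCluster ω s)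
              ∂(prodBernoulli w))
    (hB2 : ∀ (n : ℕ) (w : Sym2 (Fin n) → unitInterval) (S S' : Finset (Fin n))
        (F G : Set (Sym2 (Fin n)) → ℝ), Monotone F → Monotone G → Disjoint S S' →
        (prodBernoulli w).real
            {ω : BondConfig (Fin n) | ∀ s ∈ S, ∀ x ∈ S', ¬ (openGraph ω).Reachable s x} *
          (∫ ω in {ω : BondConfig (Fin n) | ∀ s ∈ S, ∀ x ∈ S', ¬ (openGraph ω).Reachable s x},
            F (⋃ s ∈ S, openEdgeCluster ω s) * G (⋃ s ∈ S', openEdgeCluster ω s)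
              ∂(prodBernoulli w)) ≤
        (∫ ω in {ω : BondConfig (Fin n) | ∀ s ∈ S, ∀ x ∈ S', ¬ (openGraph ω).Reachable s x},
            F (⋃ s ∈ S, openEdgeCluster ω s) ∂(prodBernoulli w)) *
          (∫ ω in {ω : BondConfig (Fin n) | ∀ s ∈ S, ∀ x ∈ S', ¬ (openGraph ω).Reachable s x},
            G (⋃ s ∈ S', openEdgeCluster ω s) ∂(prodBernoulli w)))
    (w : Sym2 (Fin n) → unitInterval) (o b a₁ a₂ a₃ : Fin n)
    (h12 : a₁ ≠ a₂) (h13 : a₁ ≠ a₃) (h23 : a₂ ≠ a₃)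
    (hτ31 : (prodBernoulli w).real (openConn a₃ b) ≤ (prodBernoulli w).real (openConn a₁ b))
    (hτ32 : (prodBernoulli w).real (openConn a₃ b) ≤ (prodBernoulli w).real (openConn a₂ b))
    (hbad : (prodBernoulli w).real ((openConn a₁ a₃)ᶜ ∩ (openConn a₂ a₃)ᶜ ∩ (openConn a₁ b ∩ openConn a₂ b)) <
      (prodBernoulli w).real ((openConn a₁ a₃)ᶜ ∩ (openConn a₂ a₃)ᶜ ∩ openConn a₃ b))
    (hS : (prodBernoulli w).real ((openConn a₁ a₃)ᶜ ∩ (openConn a₂ a₃)ᶜ ∩ ((openConn a₁ o ∪ openConn a₂ o) ∩ openConn a₃ b)) *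
            ((prodBernoulli w).real ((openConn a₁ a₃)ᶜ ∩ (openConn a₂ a₃)ᶜ ∩ openConn a₃ b) -
              (prodBernoulli w).real ((openConn a₁ a₃)ᶜ ∩ (openConn a₂ a₃)ᶜ ∩ (openConn a₁ b ∩ openConn a₂ b))) *
            (prodBernoulli w).real ((openConn a₁ a₂)ᶜ ∩ (openConn a₁ a₃)ᶜ ∩ openConn a₁ b) *
            (prodBernoulli w).real ((openConn a₂ a₁)ᶜ ∩ (openConn a₂ a₃)ᶜ ∩ openConn a₂ b) ≤
        (prodBernoulli w).real ((openConn a₁ a₂)ᶜ ∩ (openConn a₁ a₃)ᶜ ∩ (openConn a₁ o ∩ openConn a₁ b)) *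
              ((prodBernoulli w).real ((openConn a₁ a₂)ᶜ ∩ (openConn a₁ a₃)ᶜ ∩ openConn a₁ b) -
                (prodBernoulli w).real ((openConn a₁ a₂)ᶜ ∩ (openConn a₁ a₃)ᶜ ∩ (openConn a₂ b ∩ openConn a₃ b))) *
              (prodBernoulli w).real ((openConn a₂ a₁)ᶜ ∩ (openConn a₂ a₃)ᶜ ∩ openConn a₂ b) *
              (prodBernoulli w).real ((openConn a₁ a₃)ᶜ ∩ (openConn a₂ a₃)ᶜ ∩ openConn a₃ b) +
          (prodBernoulli w).real ((openConn a₂ a₁)ᶜ ∩ (openConn a₂ a₃)ᶜ ∩ (openConn a₂ o ∩ openConn a₂ b)) *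
              ((prodBernoulli w).real ((openConn a₂ a₁)ᶜ ∩ (openConn a₂ a₃)ᶜ ∩ openConn a₂ b) -
                (prodBernoulli w).real ((openConn a₂ a₁)ᶜ ∩ (openConn a₂ a₃)ᶜ ∩ (openConn a₁ b ∩ openConn a₃ b))) *
              (prodBernoulli w).real ((openConn a₁ a₂)ᶜ ∩ (openConn a₁ a₃)ᶜ ∩ openConn a₁ b) *
              (prodBernoulli w).real ((openConn a₁ a₃)ᶜ ∩ (openConn a₂ a₃)ᶜ ∩ openConn a₃ b) +
          (prodBernoulli w).real
                ((openConn o a₁ ∪ openConn o a₂ ∪ openConn o a₃)ᶜ ∩ (openConn a₃ b)ᶜ : Set (BondConfig (Fin n))) *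
              (prodBernoulli w).real ((openConn a₁ a₂)ᶜ ∩ (openConn a₁ a₃)ᶜ ∩ openConn a₁ b) *
              (prodBernoulli w).real ((openConn a₂ a₁)ᶜ ∩ (openConn a₂ a₃)ᶜ ∩ openConn a₂ b) *
              (prodBernoulli w).real ((openConn a₁ a₃)ᶜ ∩ (openConn a₂ a₃)ᶜ ∩ openConn a₃ b)) :
    (prodBernoulli w).real ((openConn o a₁ ∪ openConn o a₂ ∪ openConn o a₃) \ openConn o b) ≤
      (prodBernoulli w).real ((openConn a₃ b)ᶜ : Set (BondConfig (Fin n))) := by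
  obtain ⟨hP₁₂, hP₁, hP₂⟩ := knThm2_region_pos w b a₁ a₂ a₃ hτ31 hτ32 hbad
  obtain ⟨hm₃, hm₁, hm₂⟩ := knThm2_psi_pos w b a₁ a₂ a₃ hτ31 hτ32 hbad
  have hX := knThm2_psi_core hB1 hB2 w o b a₁ a₂ a₃ h12 h13 h23 hP₁₂ hP₁ hP₂ hm₃ hm₁ hm₂ hS
  have hm : ∀ s : Set (BondConfig (Fin n)), MeasurableSet s := fun _ => MeasurableSet.of_discrete
  have h1 := measureReal_inter_add_sdiff (μ := prodBernoulli w)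
    (s := openConn o a₁ ∪ openConn o a₂ ∪ openConn o a₃) (hm (openConn o b))
  have h2 := measureReal_inter_add_sdiff (μ := prodBernoulli w)
    (s := openConn o a₁ ∪ openConn o a₂ ∪ openConn o a₃) (hm (openConn a₃ b))
  have h3 := measureReal_inter_add_sdiff (μ := prodBernoulli w)
    (s := ((openConn a₃ b)ᶜ : Set (BondConfig (Fin n)))) (hm (openConn o a₁ ∪ openConn o a₂ ∪ openConn o a₃))
  have e1 : ((openConn a₃ b)ᶜ : Set (BondConfig (Fin n))) ∩ (openConn o a₁ ∪ openConn o a₂ ∪ openConn o a₃) =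
      (openConn o a₁ ∪ openConn o a₂ ∪ openConn o a₃) \ openConn a₃ b := by
    ext ω; simp only [Set.mem_inter_iff, Set.mem_compl_iff, Set.mem_sdiff]; tauto
  have e2 : ((openConn a₃ b)ᶜ : Set (BondConfig (Fin n))) \ (openConn o a₁ ∪ openConn o a₂ ∪ openConn o a₃) =
      (openConn o a₁ ∪ openConn o a₂ ∪ openConn o a₃)ᶜ ∩ (openConn a₃ b)ᶜ := by
    ext ω; simp only [Set.mem_inter_iff, Set.mem_compl_iff, Set.mem_sdiff]; tauto
  rw [e1, e2] at h3
  linarith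

/-- **Additive gluing for three relays, reduced to the ψ-certificate (Ψ).**  If (Ψ) holds whenever `a₃` is a worst
relay, `o` is strictly less reliable than `a₃` and `m₁₂ < m₃`, then for all three distinct relays with
`μ(a₃ ↔ b) ≥ 1 − t` and `a₃` worst: `μ({o ↔ A} ∖ {o ↔ b}) ≤ t`.  Cases: `τ(o) ≥ τ₃` (then
`μ(o↔A ∖ o↔b) ≤ μ(o↮b) ≤ μ(a₃↮b)`); `m₃ ≤ m₁₂` = Kozma–Nitzan's Theorem 2 (`knThm2_core` with the landed
`stub_bhkSets`, `stub_knLemma2`); `m₁₂ < m₃` = `knThm2_psi_eform`. [cite: KozmaNitzan2024, Theorem 2 (§3.2, pp. 8–9)] -/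
theorem additiveGluing_threeRelays_of_psiCert
    (hpsi : ∀ (n : ℕ) (w : Sym2 (Fin n) → unitInterval) (o b a₁ a₂ a₃ : Fin n),
      a₁ ≠ a₂ → a₁ ≠ a₃ → a₂ ≠ a₃ →
      (prodBernoulli w).real (openConn a₃ b) ≤ (prodBernoulli w).real (openConn a₁ b) →
      (prodBernoulli w).real (openConn a₃ b) ≤ (prodBernoulli w).real (openConn a₂ b) →
      (prodBernoulli w).real (openConn o b) < (prodBernoulli w).real (openConn a₃ b) →
      (prodBernoulli w).real ((openConn a₁ a₃)ᶜ ∩ (openConn a₂ a₃)ᶜ ∩ (openConn a₁ b ∩ openConn a₂ b)) <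
        (prodBernoulli w).real ((openConn a₁ a₃)ᶜ ∩ (openConn a₂ a₃)ᶜ ∩ openConn a₃ b) →
      (prodBernoulli w).real ((openConn a₁ a₃)ᶜ ∩ (openConn a₂ a₃)ᶜ ∩ ((openConn a₁ o ∪ openConn a₂ o) ∩ openConn a₃ b)) *
            ((prodBernoulli w).real ((openConn a₁ a₃)ᶜ ∩ (openConn a₂ a₃)ᶜ ∩ openConn a₃ b) -
              (prodBernoulli w).real ((openConn a₁ a₃)ᶜ ∩ (openConn a₂ a₃)ᶜ ∩ (openConn a₁ b ∩ openConn a₂ b))) *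
            (prodBernoulli w).real ((openConn a₁ a₂)ᶜ ∩ (openConn a₁ a₃)ᶜ ∩ openConn a₁ b) *
            (prodBernoulli w).real ((openConn a₂ a₁)ᶜ ∩ (openConn a₂ a₃)ᶜ ∩ openConn a₂ b) ≤
        (prodBernoulli w).real ((openConn a₁ a₂)ᶜ ∩ (openConn a₁ a₃)ᶜ ∩ (openConn a₁ o ∩ openConn a₁ b)) *
              ((prodBernoulli w).real ((openConn a₁ a₂)ᶜ ∩ (openConn a₁ a₃)ᶜ ∩ openConn a₁ b) -
                (prodBernoulli w).real ((openConn a₁ a₂)ᶜ ∩ (openConn a₁ a₃)ᶜ ∩ (openConn a₂ b ∩ openConn a₃ b))) *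
              (prodBernoulli w).real ((openConn a₂ a₁)ᶜ ∩ (openConn a₂ a₃)ᶜ ∩ openConn a₂ b) *
              (prodBernoulli w).real ((openConn a₁ a₃)ᶜ ∩ (openConn a₂ a₃)ᶜ ∩ openConn a₃ b) +
          (prodBernoulli w).real ((openConn a₂ a₁)ᶜ ∩ (openConn a₂ a₃)ᶜ ∩ (openConn a₂ o ∩ openConn a₂ b)) *
              ((prodBernoulli w).real ((openConn a₂ a₁)ᶜ ∩ (openConn a₂ a₃)ᶜ ∩ openConn a₂ b) -
                (prodBernoulli w).real ((openConn a₂ a₁)ᶜ ∩ (openConn a₂ a₃)ᶜ ∩ (openConn a₁ b ∩ openConn a₃ b))) *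
              (prodBernoulli w).real ((openConn a₁ a₂)ᶜ ∩ (openConn a₁ a₃)ᶜ ∩ openConn a₁ b) *
              (prodBernoulli w).real ((openConn a₁ a₃)ᶜ ∩ (openConn a₂ a₃)ᶜ ∩ openConn a₃ b) +
          (prodBernoulli w).real
                ((openConn o a₁ ∪ openConn o a₂ ∪ openConn o a₃)ᶜ ∩ (openConn a₃ b)ᶜ : Set (BondConfig (Fin n))) *
              (prodBernoulli w).real ((openConn a₁ a₂)ᶜ ∩ (openConn a₁ a₃)ᶜ ∩ openConn a₁ b) *
              (prodBernoulli w).real ((openConn a₂ a₁)ᶜ ∩ (openConn a₂ a₃)ᶜ ∩ openConn a₂ b) *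
              (prodBernoulli w).real ((openConn a₁ a₃)ᶜ ∩ (openConn a₂ a₃)ᶜ ∩ openConn a₃ b)) :
    ∀ (n : ℕ) (w : Sym2 (Fin n) → unitInterval) (o b a₁ a₂ a₃ : Fin n) (t : ℝ),
      a₁ ≠ a₂ → a₁ ≠ a₃ → a₂ ≠ a₃ →
      1 - t ≤ (prodBernoulli w).real (openConn a₃ b) →
      (prodBernoulli w).real (openConn a₃ b) ≤ (prodBernoulli w).real (openConn a₁ b) →
      (prodBernoulli w).real (openConn a₃ b) ≤ (prodBernoulli w).real (openConn a₂ b) →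
      (prodBernoulli w).real ((openConn o a₁ ∪ openConn o a₂ ∪ openConn o a₃) \ openConn o b) ≤ t := by
  intro n w o b a₁ a₂ a₃ t h12 h13 h23 hτ3 hτ31 hτ32
  have hm : ∀ s : Set (BondConfig (Fin n)), MeasurableSet s := fun _ => MeasurableSet.of_discrete
  have hc3 : (prodBernoulli w).real ((openConn a₃ b)ᶜ : Set (BondConfig (Fin n))) =
      1 - (prodBernoulli w).real (openConn a₃ b : Set (BondConfig (Fin n))) := probReal_compl_eq_one_sub (hm _)
  suffices hE : (prodBernoulli w).real ((openConn o a₁ ∪ openConn o a₂ ∪ openConn o a₃) \ openConn o b) ≤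
      (prodBernoulli w).real ((openConn a₃ b)ᶜ : Set (BondConfig (Fin n))) by linarith
  by_cases hob : (prodBernoulli w).real (openConn a₃ b) ≤ (prodBernoulli w).real (openConn o b)
  · have hco : (prodBernoulli w).real ((openConn o b)ᶜ : Set (BondConfig (Fin n))) =
        1 - (prodBernoulli w).real (openConn o b : Set (BondConfig (Fin n))) := probReal_compl_eq_one_sub (hm _)
    have hsub : (prodBernoulli w).real ((openConn o a₁ ∪ openConn o a₂ ∪ openConn o a₃) \ openConn o b) ≤
        (prodBernoulli w).real ((openConn o b)ᶜ : Set (BondConfig (Fin n))) :=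
      measureReal_mono (fun ω hω => hω.2)
    linarith
  · push Not at hob
    by_cases hgood : (prodBernoulli w).real (openConn b a₃ ∩ (openConn b a₁)ᶜ ∩ (openConn b a₂)ᶜ) ≤
        (prodBernoulli w).real (openConn b a₁ ∩ openConn b a₂ ∩ (openConn b a₃)ᶜ)
    · have hX := knThm2_core stub_bhkSets.1 stub_bhkSets.2 (stub_knLemma2 stub_bhkSets) w o b a₁ a₂ a₃
        h12 h13 h23 hτ31 hτ32 hgood
      have h1 := measureReal_inter_add_sdiff (μ := prodBernoulli w)
        (s := openConn o a₁ ∪ openConn o a₂ ∪ openConn o a₃) (hm (openConn o b))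
      have h2 := measureReal_inter_add_sdiff (μ := prodBernoulli w)
        (s := openConn o a₁ ∪ openConn o a₂ ∪ openConn o a₃) (hm (openConn a₃ b))
      have h3 : (prodBernoulli w).real ((openConn o a₁ ∪ openConn o a₂ ∪ openConn o a₃) \ openConn a₃ b) ≤
          (prodBernoulli w).real ((openConn a₃ b)ᶜ : Set (BondConfig (Fin n))) :=
        measureReal_mono fun ω hω => hω.2
      linarith
    · push Not at hgood
      rw [knThm2_m3, knThm2_m12] at hgood
      exact knThm2_psi_eform stub_bhkSets.1 stub_bhkSets.2 w o b a₁ a₂ a₃ h12 h13 h23 hτ31 hτ32 hgood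
        (hpsi n w o b a₁ a₂ a₃ h12 h13 h23 hτ31 hτ32 hob hgood)

end

end Summit.CriticalPhenomena.PercolationContinuityZ3.Theorems
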